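import Summits.BirchSwinnertonDyer.BirchSwinnertonDyer.Theorems.ByReductionTypeAtTwoSupersingularFlatBlindTwistSideKummerLine
import Summits.BirchSwinnertonDyer.BirchSwinnertonDyer.Theorems.ByReductionTypeAtTwoSupersingularFlatBlindTwistSideStructures
import Summits.BirchSwinnertonDyer.BirchSwinnertonDyer.Theorems.ByReductionTypeAtTwoSupersingularFlatBlindLocalTransversalityApZero
import Summits.BirchSwinnertonDyer.Rank1Residual.X11b.CongruentSelmerTransferTransport
import Summits.BirchSwinnertonDyer.Rank1Residual.X11b.KummerRelaxedStructures
import Literature.NumberTheory.EllipticCurves.ZpExtensionGaloisTwistSharpFlatSelmerStructure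
import Literature.NumberTheory.EllipticCurves.Sprung2012.SharpFlatSelmerDualExistsProofs
import Literature.NumberTheory.EllipticCurves.IwasawaEulerCharDualityProofs
import Literature.NumberTheory.EllipticCurves.QuadraticTwist
import Literature.NumberTheory.EllipticCurves.PAdicGrossZagierConstantTermProofs
import Literature.NumberTheory.EllipticCurves.SerreOpenImageOrdinaryInertiaProofs
import Literature.NumberTheory.EllipticCurves.LFunctionPrimeCoeff
import Literature.NumberTheory.EllipticCurves.MordellWeilProofs
import Literature.NumberTheory.DiophantineGeometry.LocalReductionProofs
import HarnessLib

/-!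
# Hand HT-2 of CDF_glob (crux `SupersingularRankZeroAtTwo`, line `odd_blind_package`, slot 5): the TWIST-SIDE uniform
# bound `∃ C, ∀ J, #H¹_{𝓕^⊥_J,S₀} · [H¹_{𝓕^⊤_J,S₀} : H¹_{𝓕^{K_J}_J,S₀}] ≤ C`

Cell `bsd-2adic`, seat `bsd-2adic-tower-1` GEN 58, `--supports stmt-BirchSwinnertonDyer-19097` (helper). HONEST FRAMING:
THEOREMS ONLY (no `def`, no named fact, no instance, no `sorry`); nothing is booked; this is ONE hand (HT-2) of the LEAD's
composition HT-1 ∧ HT-2 ∧ HT-3 ⟹ `OddBlindPackage.FlatBlindControlOfLocalAtTwo` (LEAD ss-1 GEN 19,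
`ss/gen19/HAND-TARGETS-CDFglob.md`); CDF_glob, `SupersingularRankZeroAtTwo` and BSD are NOT proved by any of this.

## Statement (the LEAD's h1, VERBATIM up to the proof-irrelevant `hu`)

`HT2_exists_bound_strict_mul_relindex`: for `W/ℚ` good supersingular at `2`, `κ` cyclotomic, the place `v ∋ 2` with a local
topological generator `g`, a finite `S₀ ∌ v` off which `W` is good, and the rank-one twist `W₂` (`C • W.quadraticTwist 2 = W₂`,
`rank_ℤ W₂(ℚ) = 1`, `Ш(W₂)[2^∞]` finite): the product of the order of the Selmer group of `𝓕^⊥_J = W.twistedSelmerStructureOfLocal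
2 S₀ κ J (-1) hu (ker[v ↦ ⊥])` and of the index `[H¹_{𝓕^⊤_J} : H¹_{𝓕^{K_J}_J}]` (`K_J` = the Kummer line of the `ψ₂`-vectors
`A_ψ = E(ℚ_{1,v}) ∩ ker (g + 1)`) is bounded independently of `J`.

## Proof (assembly of the seat's five helper files)

Transport along the dictionary `φ_J : W₂[2^J] ≅ E[2^J](χ₋₁)` (`exists_intertwining_twist`): `𝓢^X_J := (𝓕^X_J)∘H¹(ψ_J)` is a
Selmer structure on `W₂[2^J]` with `H¹_{𝓕^X_J} = H¹(φ_J)(H¹_{𝓢^X_J})` (X11b `CongruentTransfer.selmerGroup_eq_map_of_transport`),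
equal to the Kummer structure of `W₂` at every finite `v' ∉ S₀ ∪ {v}` (unramified ↦ unramified, `map_unramifiedSubgroup_eq`;
unramified = Kummer at good `v' ∤ 2`, `KummerPT.kummerSelmerStructure_inr_eq_unramifiedSubgroup`, `W₂` being good off `S₀ ∪ {2}`
by `hasGoodReductionAt_quadraticTwist`), `0` at `v` for `X = ⊥` and containing the local Kummer condition `𝓛_v` of `W₂` for
`X = K_J` (the dictionary's local clause). Then `…TwistSideStructures` bounds `#H¹_{𝓢^⊥}` and `[H¹_{𝓢^⊤} : H¹_{𝓢^K}]` by the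
slack `[H¹ : N_J] ≤ 2^{#∞} ∏_{S₀} B_{v'}²` times the rank-one quantities `#(Sel^{(2^J)}(W₂) ∩ ker res_v)` and
`[kummerOutside W₂ 2^J {v} : Sel^{(2^J)}(W₂)]`, bounded uniformly in `J` by `…TwistSideLocalIndex` (Poitou–Tate reciprocity,
Tate's local Euler characteristic, Silverman VII.6.3 at `ℚ₂`, Mordell–Weil with rank one, `Ш[2^∞]` finite).

References: [JetchevSkinnerWan2017] Prop. 3.2.1; [GreenbergLNM1716] §4 pp. 105–107, 122–124; [MilneADT2006] I Thm. 2.8,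
Rem. 3.7, Thm. 4.10 (b); [SilvermanAEC2009] VII.6.3, X.2 Prop. 2.4, X.5 Cor. 5.4, X.§4; [MazurRubin2004] Def. 2.1.1.
-/

set_option autoImplicit false
set_option linter.dupNamespace false

noncomputable section

open scoped Classical NumberField

universe u

namespace Summit.BirchSwinnertonDyer.BirchSwinnertonDyer.Theorems.FlatBlindTwistSide

open NumberField IsDedekindDomain Field WeierstrassCurve CategoryTheory Literature.NumberTheory.EllipticCurves
  Literature.NumberTheory.EllipticCurves.IwasawaDual Literature.NumberTheory.GaloisRepresentations
  Literature.NumberTheory.GaloisCohomology ZpExtension Literature.NumberTheory.EllipticCurves.Kobayashi2003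
  Literature.NumberTheory.EllipticCurves.Sprung2017 Literature.NumberTheory.EllipticCurves.Sprung2012
  Literature.NumberTheory.EllipticCurves.Rank1Residual
open Literature.NumberTheory.GaloisRepresentations.DiscreteGaloisModule (unramifiedSubgroup SelmerStructure)
open Summit.BirchSwinnertonDyer.BirchSwinnertonDyer.Theorems.OddBlindTwist (two_dvd_neg_one_sub_one)
open Summit.BirchSwinnertonDyer.Rank1Residual.X11b.CongruentTransfer
open scoped ContRepresentation

/-! ## §1 Bookkeeping over `ℚ`: the place above `2`, good reduction of the twist, the slack -/

/-- Two places of `ℚ` containing the same rational prime are equal. [folklore] -/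
theorem eq_of_natCast_mem_asIdeal (p : ℕ) [Fact p.Prime] (v v' : HeightOneSpectrum (𝓞 ℚ))
    (hv : (p : 𝓞 ℚ) ∈ v.asIdeal) (hv' : (p : 𝓞 ℚ) ∈ v'.asIdeal) : v' = v :=
  (Rat.HeightOneSpectrum.primesEquiv (R := 𝓞 ℚ)).injective
    (Subtype.ext ((primesEquiv_eq p v' hv').trans (primesEquiv_eq p v hv).symm))

/-- If `primesEquiv v = p` then `p ∈ v`. [folklore] -/
theorem natCast_mem_asIdeal_of_primesEquiv_eq (p : ℕ) (v : HeightOneSpectrum (𝓞 ℚ))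
    (h : (Rat.HeightOneSpectrum.primesEquiv (R := 𝓞 ℚ) v : ℕ) = p) : (p : 𝓞 ℚ) ∈ v.asIdeal := by
  have hdvd : Rat.HeightOneSpectrum.natGenerator v ∣ p := by
    change (Rat.HeightOneSpectrum.primesEquiv (R := 𝓞 ℚ) v : ℕ) ∣ p
    rw [h]
  have hmem := (Rat.HeightOneSpectrum.natGenerator_dvd_iff v).mp hdvd
  rw [← map_natCast (Rat.IsIntegralClosure.intEquiv (𝓞 ℚ)) p, Ideal.apply_mem_of_equiv_iff] at hmem
  exact hmem

/-- **The rank-one twist is good off `S₀ ∪ {2}`.** If `W` (globally minimal) is good at every `v' ∉ S₀` with `v' ∤ 2`, then so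
is any model `W₂` of `W^{(2)}` (`C • W.quadraticTwist 2 = W₂`): `Δ_min(W^{(2)})` differs from `Δ_min(W)` by a power of `2` at such
`v'` (tree `hasGoodReductionAt_quadraticTwist`, Silverman VII.1 Rem. 1.1 / VII.5 Prop. 5.1 (a)), and good reduction is invariant
under rational changes of variables. [cite: SilvermanAEC2009, VII.1 Remark 1.1 and VII.5 Prop. 5.1 (a)] -/
theorem hasGoodReductionAt_twist_of_not_mem (W : WeierstrassCurve ℚ) [W.IsElliptic] [W.IsGloballyMinimal]
    (S₀ : Finset (HeightOneSpectrum (𝓞 ℚ)))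
    (hbad : ∀ v' : HeightOneSpectrum (𝓞 ℚ), v' ∉ S₀ → (2 : 𝓞 ℚ) ∉ v'.asIdeal → W.HasGoodReductionAt v')
    (W₂ : WeierstrassCurve ℚ) (htw : ∃ C : WeierstrassCurve.VariableChange ℚ, C • W.quadraticTwist 2 = W₂)
    (v' : HeightOneSpectrum (𝓞 ℚ)) (hv'S : v' ∉ S₀) (h2 : ((2 : ℕ) : 𝓞 ℚ) ∉ v'.asIdeal) :
    W₂.HasGoodReductionAt v' := by
  have h2' : (2 : 𝓞 ℚ) ∉ v'.asIdeal := by exact_mod_cast h2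
  have hW : W.HasGoodReductionAt v' := hbad v' hv'S h2'
  haveI : Fact (Rat.HeightOneSpectrum.primesEquiv (R := 𝓞 ℚ) v' : ℕ).Prime := ⟨(Rat.HeightOneSpectrum.primesEquiv v').2⟩
  have hW' : W.HasGoodReductionAtPrime (Rat.HeightOneSpectrum.primesEquiv (R := 𝓞 ℚ) v' : ℕ) :=
    (hasGoodReductionAtPrime_iff_hasGoodReductionAt_ringOfIntegers (v := v') W).mpr hW
  have hΔ := not_dvd_minimalDiscriminantInt_of_hasGoodReductionAtPrime' W _ hW'
  have hne2 : (Rat.HeightOneSpectrum.primesEquiv (R := 𝓞 ℚ) v' : ℕ) ≠ 2 := fun h ↦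
    h2 (natCast_mem_asIdeal_of_primesEquiv_eq 2 v' h)
  have hp : (Rat.HeightOneSpectrum.primesEquiv (R := 𝓞 ℚ) v' : ℕ).Prime := (Rat.HeightOneSpectrum.primesEquiv v').2
  have hpd : ¬ ((Rat.HeightOneSpectrum.primesEquiv (R := 𝓞 ℚ) v' : ℕ) : ℤ) ∣ 2 * (2 : ℤ) := by
    intro h
    have h4 : (Rat.HeightOneSpectrum.primesEquiv (R := 𝓞 ℚ) v' : ℕ) ∣ 2 * 2 := by exact_mod_cast h
    rcases (Nat.Prime.dvd_mul hp).mp h4 with h | h <;>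
      exact hne2 ((Nat.prime_dvd_prime_iff_eq hp Nat.prime_two).mp h)
  have htwist := W.hasGoodReductionAt_quadraticTwist v' (d := 2) hpd hΔ
  rw [show ((2 : ℤ) : ℚ) = 2 by norm_num] at htwist
  obtain ⟨C, rfl⟩ := htw
  exact (hasGoodReductionAt_smul_iff_holds v' (W.quadraticTwist 2) C).mpr htwist

/-- **The slack is bounded, uniformly in the level.** For `W₂` over `ℚ`, a finite `S₀` of places prime to `2`: there is `D` with
`[H¹(ℚ, W₂[2^k]) : N_k] ≠ 0` and `≤ D` for every `k ≥ 1`, `N_k` the Kummer conditions at `S₀ ∪ ∞`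
(`≤ 2^{#∞}` from the real place, `≤ B_{v'}²` at `v' ∈ S₀`). [cite: MilneADT2006, Ch. I Rem. 3.7, Thm. 2.8, Lemma 3.3] -/
theorem exists_index_slack_le (W₂ : WeierstrassCurve ℚ) [W₂.IsElliptic] (S₀ : Finset (HeightOneSpectrum (𝓞 ℚ)))
    (hS₀ : ∀ v' ∈ S₀, ((2 : ℕ) : 𝓞 ℚ) ∉ v'.asIdeal) :
    ∃ D : ℕ, ∀ k : ℕ, 1 ≤ k →
      ((⨅ w : InfinitePlace ℚ, (W₂.kummerSelmerStructure (((2 ^ k : ℕ) : ℤ)) (Sum.inl w)).comap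
          (galoisCohomology.localization (W₂.torsionGaloisModule (((2 ^ k : ℕ) : ℤ))) (Sum.inl w) 1)) ⊓
        ⨅ v' ∈ S₀, (W₂.kummerSelmerStructure (((2 ^ k : ℕ) : ℤ)) (Sum.inr v')).comap
          (galoisCohomology.localization (W₂.torsionGaloisModule (((2 ^ k : ℕ) : ℤ))) (Sum.inr v') 1)).index ≠ 0 ∧
      ((⨅ w : InfinitePlace ℚ, (W₂.kummerSelmerStructure (((2 ^ k : ℕ) : ℤ)) (Sum.inl w)).comap
          (galoisCohomology.localization (W₂.torsionGaloisModule (((2 ^ k : ℕ) : ℤ))) (Sum.inl w) 1)) ⊓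
        ⨅ v' ∈ S₀, (W₂.kummerSelmerStructure (((2 ^ k : ℕ) : ℤ)) (Sum.inr v')).comap
          (galoisCohomology.localization (W₂.torsionGaloisModule (((2 ^ k : ℕ) : ℤ))) (Sum.inr v') 1)).index ≤ D := by
  haveI : Fact (Nat.Prime 2) := ⟨Nat.prime_two⟩
  -- a uniform bound at each `v' ∈ S₀`
  have hD : ∀ v' : HeightOneSpectrum (𝓞 ℚ), ∃ D : ℕ, 0 < D ∧ (v' ∈ S₀ → ∀ k : ℕ, 1 ≤ k →
      ((W₂.kummerSelmerStructure (((2 ^ k : ℕ) : ℤ)) (Sum.inr v')).comap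
          (galoisCohomology.localization (W₂.torsionGaloisModule (((2 ^ k : ℕ) : ℤ))) (Sum.inr v') 1)).index ≠ 0 ∧
      ((W₂.kummerSelmerStructure (((2 ^ k : ℕ) : ℤ)) (Sum.inr v')).comap
          (galoisCohomology.localization (W₂.torsionGaloisModule (((2 ^ k : ℕ) : ℤ))) (Sum.inr v') 1)).index ≤ D) := by
    intro v'
    by_cases hv' : v' ∈ S₀
    · obtain ⟨D, hD0, hDk⟩ := exists_index_comap_kummer_le_of_not_mem W₂ 2 v' (hS₀ v' hv')
      exact ⟨D, hD0, fun _ ↦ hDk⟩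
    · exact ⟨1, one_pos, fun h ↦ absurd h hv'⟩
  choose Df hDf0 hDf using hD
  refine ⟨2 ^ Fintype.card (InfinitePlace ℚ) * ∏ v' ∈ S₀, Df v', fun k hk ↦ ?_⟩
  have hn0 : (((2 ^ k : ℕ) : ℤ)) ≠ 0 := by exact_mod_cast pow_ne_zero k two_ne_zero
  -- the infinite part
  have hinf : (⨅ w : InfinitePlace ℚ, (W₂.kummerSelmerStructure (((2 ^ k : ℕ) : ℤ)) (Sum.inl w)).comap
      (galoisCohomology.localization (W₂.torsionGaloisModule (((2 ^ k : ℕ) : ℤ))) (Sum.inl w) 1)).index ≠ 0 ∧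
      (⨅ w : InfinitePlace ℚ, (W₂.kummerSelmerStructure (((2 ^ k : ℕ) : ℤ)) (Sum.inl w)).comap
      (galoisCohomology.localization (W₂.torsionGaloisModule (((2 ^ k : ℕ) : ℤ))) (Sum.inl w) 1)).index ≤
        2 ^ Fintype.card (InfinitePlace ℚ) := by
    constructor
    · exact AddSubgroup.index_iInf_ne_zero fun w ↦
        (index_comap_kummer_infinitePlace_ne_zero_and_le_two W₂ w _ hn0).1
    · refine (AddSubgroup.index_iInf_le _).trans ?_
      rw [← Finset.card_univ, ← Finset.prod_const]
      exact Finset.prod_le_prod' fun w _ ↦ (index_comap_kummer_infinitePlace_ne_zero_and_le_two W₂ w _ hn0).2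
  -- the `S₀` part, as an infimum over the subtype
  have hS : (⨅ v' ∈ S₀, (W₂.kummerSelmerStructure (((2 ^ k : ℕ) : ℤ)) (Sum.inr v')).comap
      (galoisCohomology.localization (W₂.torsionGaloisModule (((2 ^ k : ℕ) : ℤ))) (Sum.inr v') 1)) =
      ⨅ v' : S₀, (W₂.kummerSelmerStructure (((2 ^ k : ℕ) : ℤ)) (Sum.inr (v' : HeightOneSpectrum (𝓞 ℚ)))).comap
        (galoisCohomology.localization (W₂.torsionGaloisModule (((2 ^ k : ℕ) : ℤ)))
          (Sum.inr (v' : HeightOneSpectrum (𝓞 ℚ))) 1) := by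
    rw [iInf_subtype']
  have hfin : (⨅ v' ∈ S₀, (W₂.kummerSelmerStructure (((2 ^ k : ℕ) : ℤ)) (Sum.inr v')).comap
      (galoisCohomology.localization (W₂.torsionGaloisModule (((2 ^ k : ℕ) : ℤ))) (Sum.inr v') 1)).index ≠ 0 ∧
      (⨅ v' ∈ S₀, (W₂.kummerSelmerStructure (((2 ^ k : ℕ) : ℤ)) (Sum.inr v')).comap
      (galoisCohomology.localization (W₂.torsionGaloisModule (((2 ^ k : ℕ) : ℤ))) (Sum.inr v') 1)).index ≤
        ∏ v' ∈ S₀, Df v' := by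
    rw [hS]
    constructor
    · exact AddSubgroup.index_iInf_ne_zero fun v' ↦ (hDf v'.1 v'.2 k hk).1
    · refine (AddSubgroup.index_iInf_le _).trans ?_
      rw [← Finset.prod_attach S₀]
      exact Finset.prod_le_prod' fun v' _ ↦ (hDf v'.1 v'.2 k hk).2
  exact ⟨AddSubgroup.index_inf_ne_zero hinf.1 hfin.1, AddSubgroup.index_inf_le.trans (Nat.mul_le_mul hinf.2 hfin.2)⟩

/-! ## §2 The hand -/

section Hand

variable (W : WeierstrassCurve ℚ) [W.IsElliptic] [W.IsGloballyMinimal]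

/-- **HT-2 (TWIST SIDE, uniform in `J`): the strict group and the «relaxed : Kummer-line» index at `2` are bounded.**
Binders: the line's through `(hv)` + `g` + a finite `S₀ ∌ v` containing the bad places + the K67-CD twist tail
`(W₂, htw, hr, hsha, ι, P, hP)`. `∃ C, ∀ J, #H¹_{𝓕^0_J,S₀} · [H¹_{𝓖'_J,S₀} : H¹_{𝓕^K_J,S₀}] ≤ C`. Proof: transport along the twist
dictionary `W₂[2^J] ≅ E[2^J](χ₋₁)` (`exists_intertwining_twist`) to Selmer structures on `W₂[2^J]` that are Kummer off
`S₀ ∪ {v} ∪ ∞`, `0` at `v`, resp. containing the Kummer condition of `W₂(ℚ_v)` at `v`; then the rank-one counts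
(`…TwistSideLocalIndex`: `#(Sel^{(2^J)}(W₂) ∩ ker res_v)` and `[kummerOutside W₂ 2^J {v} : Sel^{(2^J)}(W₂)]` bounded
uniformly in `J` — Poitou–Tate reciprocity, Tate's local Euler characteristic, Silverman VII.6.3) against the bounded slack of
the conditions at `S₀ ∪ ∞` (`…TwistSideStructures`). [cite: JetchevSkinnerWan2017, Prop. 3.2.1]
[cite: GreenbergLNM1716, §4 pp. 122–124] [cite: MilneADT2006, Ch. I, Thm. 4.10 (b), Thm. 2.8, Rem. 3.7] -/
theorem HT2_exists_bound_strict_mul_relindex (hss : GoodSS W 2)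
    {κ : ZpExtension ℚ 2} (hκ : κ.IsCyclotomic) (v : HeightOneSpectrum (𝓞 ℚ)) (hv : (2 : 𝓞 ℚ) ∈ v.asIdeal)
    {g : absoluteGaloisGroup (v.adicCompletion ℚ)}
    (hg : κ.IsTopGenerator (resGalOfEmb (closureEmb (K := ℚ) (v.adicCompletion ℚ)) g))
    (S₀ : Finset (HeightOneSpectrum (𝓞 ℚ))) (hvS : v ∉ S₀)
    (hbad : ∀ v' : HeightOneSpectrum (𝓞 ℚ), v' ∉ S₀ → (2 : 𝓞 ℚ) ∉ v'.asIdeal → W.HasGoodReductionAt v')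
    (W₂ : WeierstrassCurve ℚ) [W₂.IsElliptic] [W₂.IsGloballyMinimal]
    (htw : ∃ C : WeierstrassCurve.VariableChange ℚ, C • W.quadraticTwist 2 = W₂)
    (hr : W₂.mordellWeilRank = 1) (hsha : Finite (AddCommGroup.primaryComponent W₂.sha 2))
    (ι : ℚ →+* ℚ_[2]) (P : (W₂.baseChange ℚ).toAffine.Point) (hP : ¬ IsOfFinAddOrder P) :
    ∃ C : ℕ, ∀ J : ℕ,
      Nat.card (W.twistedSelmerStructureOfLocal 2 S₀ κ J (-1) two_dvd_neg_one_sub_one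
          (Function.update (fun v' ↦ (W.twistedTorsionToLocalH1 2 κ J (-1) two_dvd_neg_one_sub_one
            (v'.adicCompletion ℚ)).ker) v ⊥)).selmerGroup *
        Nat.card ((W.twistedSelmerStructureOfLocal 2 S₀ κ J (-1) two_dvd_neg_one_sub_one
            (Function.update (fun v' ↦ (W.twistedTorsionToLocalH1 2 κ J (-1) two_dvd_neg_one_sub_one
              (v'.adicCompletion ℚ)).ker) v
              ⊤)).selmerGroup ⧸
          ((W.twistedSelmerStructureOfLocal 2 S₀ κ J (-1) two_dvd_neg_one_sub_one
            (Function.update (fun v' ↦ (W.twistedTorsionToLocalH1 2 κ J (-1) two_dvd_neg_one_sub_one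
              (v'.adicCompletion ℚ)).ker) v
              (W.twistedTorsionLocalKummer 2 κ J (-1) two_dvd_neg_one_sub_one (v.adicCompletion ℚ)
                (localLayerPointsOfEmb κ (closureEmb (K := ℚ) (v.adicCompletion ℚ)) W 1 ⊓
                  (DistribSMul.toAddMonoidHom (localPoints W (v.adicCompletion ℚ)) g +
                    AddMonoidHom.id _).ker)))).selmerGroup).addSubgroupOf
          (W.twistedSelmerStructureOfLocal 2 S₀ κ J (-1) two_dvd_neg_one_sub_one
            (Function.update (fun v' ↦ (W.twistedTorsionToLocalH1 2 κ J (-1) two_dvd_neg_one_sub_one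
              (v'.adicCompletion ℚ)).ker) v
              ⊤)).selmerGroup) ≤ C := by
  -- `hss`, `ι`, `P`, `hP` are binders of the hand's signature that the twist side does not use
  have _h₁ := hss; have _h₂ := hP; have _h₃ := ι
  haveI : Fact (Nat.Prime 2) := ⟨Nat.prime_two⟩
  have hv2 : ((2 : ℕ) : 𝓞 ℚ) ∈ v.asIdeal := by exact_mod_cast hv
  haveI hshaI : Finite (AddCommGroup.primaryComponent W₂.sha 2) := hsha
  -- the rank-one constants on the `W₂` side
  obtain ⟨lam, hlam⟩ := exists_addMonoidHom_padicInt_adicCompletion W₂ 2 v hv2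
  obtain ⟨C₁, hC₁⟩ := @exists_natCard_selmerGroup_inf_ker_res_le ℚ _ _ W₂ _ 2 _ (v.adicCompletion ℚ) _ (_)
    (charZero_of_injective_algebraMap (algebraMap ℚ _).injective) lam hlam hr hsha W₂.finite_torsion_holds
  obtain ⟨U, hU, ⟨eU⟩⟩ := exists_finiteIndex_addEquiv_padicInt_adicCompletion W₂ 2 v hv2
  haveI := hU
  obtain ⟨C₂, hC₂⟩ := exists_relIndex_selmerGroup_kummerOutside_le W₂ 2 v U eU hr
  -- `S₀` is prime to `2`; the slack
  have hS₀ : ∀ v' ∈ S₀, ((2 : ℕ) : 𝓞 ℚ) ∉ v'.asIdeal := fun v' hv' h ↦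
    hvS ((eq_of_natCast_mem_asIdeal 2 v v' hv2 h) ▸ hv')
  obtain ⟨D, hD⟩ := exists_index_slack_le W₂ S₀ hS₀
  -- `W₂` is good off `S₀ ∪ {v}`
  have hgood : ∀ v' : HeightOneSpectrum (𝓞 ℚ), v' ∉ S₀ → ((2 : ℕ) : 𝓞 ℚ) ∉ v'.asIdeal →
      W₂.HasGoodReductionAt v' := fun v' hv'S h2 ↦
    hasGoodReductionAt_twist_of_not_mem W S₀ hbad W₂ htw v' hv'S h2
  refine ⟨max 1 (D * C₁ * (D * C₂)), fun J ↦ ?_⟩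
  rcases Nat.eq_zero_or_pos J with hJ0 | hJ
  · -- level `0`: every cohomology group in sight is trivial
    subst hJ0
    have hzero : ∀ x : galoisCohomology (W.twistedTorsionGaloisModule 2 κ 0 (-1) two_dvd_neg_one_sub_one) 1, x = 0 :=
      fun x ↦ by
        have h := galoisCohomology.nsmul_eq_zero_of_forall (W.twistedTorsionGaloisModule 2 κ 0 (-1)
          two_dvd_neg_one_sub_one) (W.pow_nsmul_geomTorsion_pow 2 0) x
        change (1 : ℕ) • x = 0 at h
        rwa [one_smul] at h
    haveI : Subsingleton (galoisCohomology (W.twistedTorsionGaloisModule 2 κ 0 (-1) two_dvd_neg_one_sub_one) 1) :=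
      ⟨fun a b ↦ by rw [hzero a, hzero b]⟩
    have h1 : ∀ (S : AddSubgroup (galoisCohomology (W.twistedTorsionGaloisModule 2 κ 0 (-1)
        two_dvd_neg_one_sub_one) 1)), Nat.card S ≤ 1 := fun S ↦
      Finite.card_le_one_iff_subsingleton.mpr inferInstance
    have h2 : ∀ (S : AddSubgroup (galoisCohomology (W.twistedTorsionGaloisModule 2 κ 0 (-1)
        two_dvd_neg_one_sub_one) 1)) (T : AddSubgroup S), Nat.card (S ⧸ T) ≤ 1 := fun S T ↦
      (Nat.card_le_card_of_surjective _ (QuotientAddGroup.mk'_surjective T)).trans (h1 S)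
    exact (Nat.mul_le_mul (h1 _) (h2 _ _)).trans ((Nat.mul_one 1).le.trans (le_max_left _ _))
  · haveI : NeZero (2 ^ J) := ⟨pow_ne_zero _ two_ne_zero⟩
    obtain ⟨hN0, hND⟩ := hD J hJ
    obtain ⟨φ, ψ, hψφ, hφψ, hloc⟩ := exists_intertwining_twist W W₂ hκ htw v hg J
    -- the transported structures
    let 𝓕 : AddSubgroup _ → SelmerStructure (W.twistedTorsionGaloisModule 2 κ J (-1) two_dvd_neg_one_sub_one) :=
      fun X ↦ W.twistedSelmerStructureOfLocal 2 S₀ κ J (-1) two_dvd_neg_one_sub_one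
        (Function.update (fun v' ↦ (W.twistedTorsionToLocalH1 2 κ J (-1) two_dvd_neg_one_sub_one
          (v'.adicCompletion ℚ)).ker) v X)
    let 𝓢 : AddSubgroup _ → SelmerStructure (W₂.torsionGaloisModule ((2 ^ J : ℕ) : ℤ)) :=
      fun X w ↦ (𝓕 X w).comap (galoisCohomology.map (φ.restrictField (Place.Completion w)) 1)
    have hinjw : ∀ w : Place ℚ, Function.Injective (galoisCohomology.map (φ.restrictField (Place.Completion w)) 1) :=
      fun w ↦ map_restrictField_injective_of_comp_eq φ ψ hψφ w
    have hsurjw : ∀ w : Place ℚ, Function.Surjective (galoisCohomology.map (φ.restrictField (Place.Completion w)) 1) :=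
      fun w y ↦ ⟨_, map_restrictField_map_restrictField_of_comp_eq ψ φ hφψ w y⟩
    have htrans : ∀ X w, 𝓕 X w = (𝓢 X w).map (galoisCohomology.map (φ.restrictField (Place.Completion w)) 1) :=
      fun X w ↦ (AddSubgroup.map_comap_eq_self_of_surjective (hsurjw w) _).symm
    have hsel : ∀ X, (𝓕 X).selmerGroup = (𝓢 X).selmerGroup.map (galoisCohomology.map φ 1) := fun X ↦
      selmerGroup_eq_map_of_transport (𝓢 X) φ ψ hψφ hφψ (𝓕 X) (htrans X)
    have hinj := Summit.BirchSwinnertonDyer.Rank1Residual.X11b.Levels.map_injective_of_comp_eq φ ψ hψφ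
    -- the structures agree with the Kummer structure of `W₂` off `S₀ ∪ {v} ∪ ∞`
    have hoff : ∀ X (v' : HeightOneSpectrum (𝓞 ℚ)), v' ∉ S₀ → v' ≠ v →
        𝓢 X (Sum.inr v') = W₂.kummerSelmerStructure (((2 ^ J : ℕ) : ℤ)) (Sum.inr v') := by
      intro X v' hv'S hv'v
      have h2v' : ((2 : ℕ) : 𝓞 ℚ) ∉ v'.asIdeal := fun h ↦ hv'v (eq_of_natCast_mem_asIdeal 2 v v' hv2 h)
      change (𝓕 X (Sum.inr v')).comap _ = _
      have hF : 𝓕 X (Sum.inr v') = unramifiedSubgroup (GaloisRep.toLocal v'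
          (W.twistedTorsionGaloisModule 2 κ J (-1) two_dvd_neg_one_sub_one)) 1 :=
        W.twistedSelmerStructureOfLocal_inr_of_not_mem 2 S₀ κ J (-1) two_dvd_neg_one_sub_one _ hv'S h2v'
      rw [hF, ← map_unramifiedSubgroup_eq φ ψ hφψ v']
      exact (AddSubgroup.comap_map_eq_self_of_injective (hinjw _) _).trans
        (Summit.BirchSwinnertonDyer.Rank1Residual.X11b.KummerPT.kummerSelmerStructure_inr_eq_unramifiedSubgroup
          W₂ 2 J h2v' (hgood v' hv'S h2v')).symm
    have hFv : ∀ X, 𝓕 X (Sum.inr v) = X := fun X ↦ by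
      change W.twistedSelmerStructureOfLocal 2 S₀ κ J (-1) two_dvd_neg_one_sub_one _ (Sum.inr v) = X
      rw [W.twistedSelmerStructureOfLocal_inr_of_mem_asIdeal 2 S₀ κ J (-1) two_dvd_neg_one_sub_one _ hvS hv2,
        Function.update_self]
    have hbot : 𝓢 ⊥ (Sum.inr v) = ⊥ := by
      change (𝓕 ⊥ (Sum.inr v)).comap _ = ⊥
      refine (eq_bot_iff).mpr fun y hy ↦ ?_
      rw [AddSubgroup.mem_comap, hFv] at hy
      rw [AddSubgroup.mem_bot]
      exact hinjw _ (((AddSubgroup.mem_bot).mp hy).trans (map_zero _).symm)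
    have hkum : ∀ X, (W₂.kummerLocalConditionAt ((2 ^ J : ℕ) : ℤ) (v.adicCompletion ℚ)).map
        (galoisCohomology.map (φ.restrictField (v.adicCompletion ℚ)) 1) ≤ X →
        W₂.kummerSelmerStructure (((2 ^ J : ℕ) : ℤ)) (Sum.inr v) ≤ 𝓢 X (Sum.inr v) := by
      intro X hX
      change _ ≤ (𝓕 X (Sum.inr v)).comap _
      rw [hFv, W₂.kummerSelmerStructure_apply]
      exact AddSubgroup.map_le_iff_le_comap.mp hX
    have heq : ∀ (X : AddSubgroup _) (w : Place ℚ), w ≠ Sum.inr v → 𝓢 X w = 𝓢 ⊤ w := by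
      intro X w hw
      change (𝓕 X w).comap _ = (𝓕 ⊤ w).comap _
      congr 1
      rcases w with w | v'
      · rfl
      · have hv'v : v' ≠ v := fun h ↦ hw (by rw [h])
        by_cases hv'S : v' ∈ S₀
        · change W.twistedSelmerStructureOfLocal 2 S₀ κ J (-1) two_dvd_neg_one_sub_one _ (Sum.inr v') =
            W.twistedSelmerStructureOfLocal 2 S₀ κ J (-1) two_dvd_neg_one_sub_one _ (Sum.inr v')
          rw [W.twistedSelmerStructureOfLocal_inr_of_mem 2 S₀ κ J (-1) two_dvd_neg_one_sub_one _ hv'S,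
            W.twistedSelmerStructureOfLocal_inr_of_mem 2 S₀ κ J (-1) two_dvd_neg_one_sub_one _ hv'S]
        · have h2v' : ((2 : ℕ) : 𝓞 ℚ) ∉ v'.asIdeal := fun h ↦ hv'v (eq_of_natCast_mem_asIdeal 2 v v' hv2 h)
          change W.twistedSelmerStructureOfLocal 2 S₀ κ J (-1) two_dvd_neg_one_sub_one _ (Sum.inr v') =
            W.twistedSelmerStructureOfLocal 2 S₀ κ J (-1) two_dvd_neg_one_sub_one _ (Sum.inr v')
          rw [W.twistedSelmerStructureOfLocal_inr_of_not_mem 2 S₀ κ J (-1) two_dvd_neg_one_sub_one _ hv'S h2v',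
            W.twistedSelmerStructureOfLocal_inr_of_not_mem 2 S₀ κ J (-1) two_dvd_neg_one_sub_one _ hv'S h2v']
    -- the two bounds on the `W₂` side
    have hstrict := natCard_selmerGroup_le_of_apply_eq_bot W₂ (2 ^ J) v S₀ (𝓢 ⊥) (hoff ⊥) hbot _ rfl hN0
    have hrelB := relIndex_selmerGroup_le_of_kummer_le W₂ (2 ^ J) v S₀ (𝓢 _) (𝓢 ⊤) (heq _) (hoff ⊤) (hkum _ hloc) _ rfl
      hN0
    -- transport of the two quantities of the hand
    have hcard : Nat.card (𝓕 ⊥).selmerGroup = Nat.card (𝓢 ⊥).selmerGroup :=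
      natCard_selmerGroup_of_transport (𝓢 ⊥) φ ψ hψφ hφψ (𝓕 ⊥) (htrans ⊥)
    have hquot : ∀ X, Nat.card ((𝓕 ⊤).selmerGroup ⧸ ((𝓕 X).selmerGroup).addSubgroupOf (𝓕 ⊤).selmerGroup) =
        ((𝓢 X).selmerGroup).relIndex (𝓢 ⊤).selmerGroup := fun X ↦ by
      change ((𝓕 X).selmerGroup).relIndex (𝓕 ⊤).selmerGroup = _
      rw [hsel X, hsel ⊤]
      exact AddSubgroup.relIndex_map_map_of_injective _ _ hinj
    change Nat.card (𝓕 ⊥).selmerGroup * Nat.card ((𝓕 ⊤).selmerGroup ⧸ ((𝓕 _).selmerGroup).addSubgroupOf _) ≤ _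
    rw [hcard, hquot]
    refine le_trans ?_ (le_max_right _ _)
    refine Nat.mul_le_mul (hstrict.trans (Nat.mul_le_mul hND (hC₁ J))) (hrelB.trans (Nat.mul_le_mul hND (hC₂ J hJ)))

end Hand

end Summit.BirchSwinnertonDyer.BirchSwinnertonDyer.Theorems.FlatBlindTwistSide

end
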